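import Mathlib
import HarnessLib
import Summits.NavierStokesRegularity.NavierStokesRegularity.Theorems.LocalVelCompTubeDoorLocalPointZoomVelSlices
import Summits.NavierStokesRegularity.NavierStokesRegularity.Theorems.LocalHelicityTubeDoorFrobeniusProfileRigiditySharper

/-!
# Door S10 `LocalVelCompTubeDoor` without a window: a velocity field everywhere ORTHOGONAL to a continuous direction
# field `n` with `n(x₀) ≠ 0` is backward bounded at every locally Type-I point `(x₀, T)`

Cell ns-regularity-ideate, seat p6 (route-directed support for the door family of LADDER-NS N0; generalises the off-axis
half of `…LocalHelicityTubeDoorAxisymNoSwirlCase.isBackwardBoundedAt_of_localTypeI_axisymmetric_noSwirl`).  The S10 door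
(rung N0-LocalTubeDoorVelComp, CLOSED·proved) asks for ONE Cartesian velocity component `⟪u, e⟫` to fade on a similarity
window; its profile crux K2′ is the strict-shadow stratum `velCompWindowRigidity` / `not_backwardSingular_of_inner_eq_zero`.
Here the fixed direction `e` is replaced by a VARIABLE direction field `n(x)`, continuous at `x₀` with `n(x₀) ≠ 0`, and
the hypothesis is exact orthogonality `⟪u(t,x), n(x)⟫ = 0` (no window, no fading rate):

* `isBackwardBoundedAt_of_localTypeI_inner_field_eq_zero` — **local Type I at `(x₀,T)` + `u(t,·) ⊥ n` near `x₀` at all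
  late times + `n` continuous at `x₀`, `n x₀ ≠ 0` ⇒ backward bounded at `(x₀,T)`.**  Proof: the velocity zoom
  `(λⱼ/ν) u(T + λⱼ²s/ν, x₀ + λⱼ y) → v(s,y)` (tree `localPointZoomVelSlices`) and `n(x₀ + λⱼ y) → n(x₀)` give
  `⟪v(s,y), n(x₀)⟫ = 0` on the slab — the strict-shadow stratum — so the backward-singular profile is not backward-singular.
* COROLLARIES (no symmetry of `u` is assumed — only a pointwise orthogonality):
  - `isBackwardBoundedAt_of_localTypeI_noSwirl_offAxis` — swirl-free (`⟪J x, u⟫ = 0`, axisymmetry NOT required) ⇒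
    backward bounded at every locally Type-I point OFF the axis;
  - `isBackwardBoundedAt_of_localTypeI_noHelicalSwirl` — no HELICAL swirl `⟪J x + h e₂, u(t,x)⟫ = 0` with pitch
    `h ≠ 0` (the helical Killing field never vanishes) ⇒ backward bounded at EVERY locally Type-I point;
  - `isBackwardBoundedAt_of_localTypeI_planar` — `⟪u, e⟫ ≡ 0` for a fixed `e ≠ 0` (e.g. planar flows) ⇒ backward
    bounded at every locally Type-I point (S10's leaf with the trivial window).

WHAT THIS IS NOT: not a claim about Navier–Stokes regularity (Clay A) — local regularity statements CONDITIONAL on local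
Type I for velocity fields constrained to a plane field; inside the reach of S10's proved crux (bears_on LADDER-NS N0).
-/

noncomputable section

-- the summit and its single sub-problem share the name (CONVENTIONS §1), as in every Theorems file
set_option linter.dupNamespace false

namespace Summit.NavierStokesRegularity.NavierStokesRegularity.Theorems.LocalVelCompTubeDoorOrthogonalField

open MeasureTheory Set Function Filter Topology TopologicalSpace Metric
open scoped RealInnerProductSpace InnerProductSpace
open Literature.Analysis Literature.Analysis.FluidPDE
open Summit.NavierStokesRegularity.NavierStokesRegularity.Theorems.LocalVelCompTubeDoorLocalPointZoomVelSlices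
open Summit.NavierStokesRegularity.NavierStokesRegularity.Theorems.LocalHelicityTubeDoorFrobeniusProfileRigiditySharper

/-- **Local Type I + velocity orthogonal to a continuous direction field with `n(x₀) ≠ 0` ⇒ backward bounded.**  For a
classical Navier–Stokes solution on `[0,T)` (Leray–Hopf from a rapidly decaying datum), locally Type I at `(x₀,T)` on one
parabolic cylinder, if `⟪u(t,x), n(x)⟫ = 0` for all `t ∈ [0,T)` late enough and all `x` near `x₀`, where `n` is continuous
at `x₀` and `n x₀ ≠ 0`, then `u` is backward bounded at `(x₀,T)`. -/
theorem isBackwardBoundedAt_of_localTypeI_inner_field_eq_zero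
    (ν T : ℝ) (hν : 0 < ν) (hT : 0 < T) (u : ℝ → EuclideanSpace ℝ (Fin 3) → EuclideanSpace ℝ (Fin 3))
    (p : ℝ → EuclideanSpace ℝ (Fin 3) → ℝ)
    (hcl : IsClassicalNSSolutionOn (Set.Ico 0 T) ν 0 u p) (hLH : IsLerayHopfOn T ν 0 (u 0) u)
    (hdec : HasRapidSpatialDecay (u 0))
    (x₀ : EuclideanSpace ℝ (Fin 3)) (ρ M : ℝ) (hρ : 0 < ρ)
    (hM : ∀ t ∈ Set.Ico 0 T, T - ρ ^ 2 < t → ∀ x ∈ Metric.ball x₀ ρ, ‖u t x‖ * Real.sqrt (ν * (T - t)) ≤ M)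
    {n : EuclideanSpace ℝ (Fin 3) → EuclideanSpace ℝ (Fin 3)} (hn : ContinuousAt n x₀) (hn0 : n x₀ ≠ 0)
    {δ : ℝ} (hδ : 0 < δ)
    (horth : ∀ t ∈ Set.Ico 0 T, T - δ ^ 2 < t → ∀ x ∈ Metric.ball x₀ δ, ⟪u t x, n x⟫_ℝ = 0) :
    IsBackwardBoundedAt u T x₀ := by
  by_contra hnot
  obtain ⟨C, v, lam, hlam, hlam0, ⟨hrate, hcont, hmild, hdiv⟩, hsing, hconv⟩ :=
    localPointZoomVelSlices ν T hν hT u p hcl hLH hdec x₀ ρ M hρ hM hnot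
  have hcomp : ∀ s < 0, ∀ y, ⟪v s y, n x₀⟫_ℝ = 0 := by
    intro s hs y
    -- the zoom points `x₀ + λⱼ y` tend to `x₀` and the zoom times `T + λⱼ² s/ν` to `T⁻`
    have hy : Tendsto (fun j => x₀ + lam j • y) atTop (𝓝 x₀) := by
      simpa only [zero_smul, add_zero] using (hlam0.smul_const y).const_add x₀
    have hnj : Tendsto (fun j => n (x₀ + lam j • y)) atTop (𝓝 (n x₀)) := hn.tendsto.comp hy
    have hlim : Tendsto (fun j => ⟪(lam j / ν) • u (T + lam j ^ 2 * s / ν) (x₀ + lam j • y), n (x₀ + lam j • y)⟫_ℝ)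
        atTop (𝓝 ⟪v s y, n x₀⟫_ℝ) := (hconv s hs y).inner hnj
    -- eventually the zoom points lie in the orthogonality region, so the inner products vanish
    have hev : ∀ᶠ j in atTop,
        ⟪(lam j / ν) • u (T + lam j ^ 2 * s / ν) (x₀ + lam j • y), n (x₀ + lam j • y)⟫_ℝ = 0 := by
      have h1 : ∀ᶠ j in atTop, x₀ + lam j • y ∈ Metric.ball x₀ δ := hy (Metric.isOpen_ball.mem_nhds (mem_ball_self hδ))
      have h2 : ∀ᶠ j in atTop, lam j ^ 2 < min (δ ^ 2 * ν / (-s)) (T * ν / (-s)) := by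
        have hsq : Tendsto (fun j => lam j ^ 2) atTop (𝓝 0) := by simpa using hlam0.pow 2
        have hpos : 0 < min (δ ^ 2 * ν / (-s)) (T * ν / (-s)) :=
          lt_min (div_pos (mul_pos (pow_pos hδ 2) hν) (neg_pos.2 hs)) (div_pos (mul_pos hT hν) (neg_pos.2 hs))
        exact hsq (Iio_mem_nhds hpos)
      filter_upwards [h1, h2] with j hj1 hj2
      have hns : 0 < -s := neg_pos.2 hs
      have hl2a : lam j ^ 2 < δ ^ 2 * ν / (-s) := hj2.trans_le (min_le_left _ _)
      have hl2b : lam j ^ 2 < T * ν / (-s) := hj2.trans_le (min_le_right _ _)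
      have ht1 : T - δ ^ 2 < T + lam j ^ 2 * s / ν := by
        have : lam j ^ 2 * (-s) < δ ^ 2 * ν := (lt_div_iff₀ hns).1 hl2a
        have h' : lam j ^ 2 * s / ν > -(δ ^ 2) := by
          rw [gt_iff_lt, lt_div_iff₀ hν]; nlinarith
        linarith
      have ht0 : 0 ≤ T + lam j ^ 2 * s / ν := by
        have : lam j ^ 2 * (-s) < T * ν := (lt_div_iff₀ hns).1 hl2b
        have h' : -(T) < lam j ^ 2 * s / ν := by
          rw [lt_div_iff₀ hν]; nlinarith
        linarith
      have htT : T + lam j ^ 2 * s / ν < T := by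
        have : lam j ^ 2 * s / ν < 0 := div_neg_of_neg_of_pos (mul_neg_of_pos_of_neg (pow_pos (hlam j) 2) hs) hν
        linarith
      rw [real_inner_smul_left, horth _ ⟨ht0, htT⟩ ht1 _ hj1, mul_zero]
    have hzero : Tendsto (fun j => ⟪(lam j / ν) • u (T + lam j ^ 2 * s / ν) (x₀ + lam j • y), n (x₀ + lam j • y)⟫_ℝ)
        atTop (𝓝 0) :=
      (tendsto_congr' (hev.mono fun j hj => hj)).2 tendsto_const_nhds
    exact tendsto_nhds_unique hlim hzero
  exact (not_backwardSingular_of_inner_eq_zero hrate hcont hmild hdiv hn0 hcomp) hsing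

/-! ### Corollaries -/

/-- **Swirl-free (axisymmetry NOT assumed) ⇒ backward bounded at every locally Type-I point OFF the axis**: the swirl
is `⟪J x, u(t,x)⟫` with `J x = (−x₁, x₀, 0)` continuous and nonzero off the axis. -/
theorem isBackwardBoundedAt_of_localTypeI_noSwirl_offAxis
    (ν T : ℝ) (hν : 0 < ν) (hT : 0 < T) (u : ℝ → EuclideanSpace ℝ (Fin 3) → EuclideanSpace ℝ (Fin 3))
    (p : ℝ → EuclideanSpace ℝ (Fin 3) → ℝ)
    (hcl : IsClassicalNSSolutionOn (Set.Ico 0 T) ν 0 u p) (hLH : IsLerayHopfOn T ν 0 (u 0) u)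
    (hdec : HasRapidSpatialDecay (u 0)) (hsw : ∀ t, HasNoSwirl (u t))
    (x₀ : EuclideanSpace ℝ (Fin 3)) (hx₀ : rotGen x₀ ≠ 0) (ρ M : ℝ) (hρ : 0 < ρ)
    (hM : ∀ t ∈ Set.Ico 0 T, T - ρ ^ 2 < t → ∀ x ∈ Metric.ball x₀ ρ, ‖u t x‖ * Real.sqrt (ν * (T - t)) ≤ M) :
    IsBackwardBoundedAt u T x₀ := by
  refine isBackwardBoundedAt_of_localTypeI_inner_field_eq_zero ν T hν hT u p hcl hLH hdec x₀ ρ M hρ hM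
    (n := rotGen) rotGenL.continuous.continuousAt hx₀ hρ fun t _ _ x _ => ?_
  have h := hsw t x
  rw [swirl_eq_inner_rotGen] at h
  rw [real_inner_comm]; exact h

/-- **No HELICAL swirl ⇒ backward bounded at EVERY locally Type-I point**: if `⟪J x + h • e₂, u(t,x)⟫ = 0` everywhere
with pitch `h ≠ 0` — the velocity is orthogonal to the helical Killing field, which vanishes nowhere — then `u` is
backward bounded at every point where it is locally Type I.  (No helical symmetry of `u` is assumed.) -/
theorem isBackwardBoundedAt_of_localTypeI_noHelicalSwirl
    (ν T : ℝ) (hν : 0 < ν) (hT : 0 < T) (u : ℝ → EuclideanSpace ℝ (Fin 3) → EuclideanSpace ℝ (Fin 3))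
    (p : ℝ → EuclideanSpace ℝ (Fin 3) → ℝ)
    (hcl : IsClassicalNSSolutionOn (Set.Ico 0 T) ν 0 u p) (hLH : IsLerayHopfOn T ν 0 (u 0) u)
    (hdec : HasRapidSpatialDecay (u 0)) {h : ℝ} (hh : h ≠ 0)
    (hhel : ∀ t x, ⟪rotGen x + h • EuclideanSpace.single 2 (1 : ℝ), u t x⟫_ℝ = 0)
    (x₀ : EuclideanSpace ℝ (Fin 3)) (ρ M : ℝ) (hρ : 0 < ρ)
    (hM : ∀ t ∈ Set.Ico 0 T, T - ρ ^ 2 < t → ∀ x ∈ Metric.ball x₀ ρ, ‖u t x‖ * Real.sqrt (ν * (T - t)) ≤ M) :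
    IsBackwardBoundedAt u T x₀ := by
  have hn0 : rotGen x₀ + h • EuclideanSpace.single 2 (1 : ℝ) ≠ 0 := by
    intro h0
    have := congrArg (fun w : EuclideanSpace ℝ (Fin 3) => w 2) h0
    simp [hh] at this
  refine isBackwardBoundedAt_of_localTypeI_inner_field_eq_zero ν T hν hT u p hcl hLH hdec x₀ ρ M hρ hM
    (n := fun x => rotGen x + h • EuclideanSpace.single 2 (1 : ℝ))
    (rotGenL.continuous.add continuous_const).continuousAt hn0 hρ fun t _ _ x _ => ?_
  rw [real_inner_comm]; exact hhel t x

/-- **One velocity component vanishing identically (e.g. planar flows) ⇒ backward bounded at every locally Type-I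
point** — the S10 leaf with the trivial window. -/
theorem isBackwardBoundedAt_of_localTypeI_planar
    (ν T : ℝ) (hν : 0 < ν) (hT : 0 < T) (u : ℝ → EuclideanSpace ℝ (Fin 3) → EuclideanSpace ℝ (Fin 3))
    (p : ℝ → EuclideanSpace ℝ (Fin 3) → ℝ)
    (hcl : IsClassicalNSSolutionOn (Set.Ico 0 T) ν 0 u p) (hLH : IsLerayHopfOn T ν 0 (u 0) u)
    (hdec : HasRapidSpatialDecay (u 0)) {e : EuclideanSpace ℝ (Fin 3)} (he : e ≠ 0)
    (hpl : ∀ t x, ⟪u t x, e⟫_ℝ = 0)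
    (x₀ : EuclideanSpace ℝ (Fin 3)) (ρ M : ℝ) (hρ : 0 < ρ)
    (hM : ∀ t ∈ Set.Ico 0 T, T - ρ ^ 2 < t → ∀ x ∈ Metric.ball x₀ ρ, ‖u t x‖ * Real.sqrt (ν * (T - t)) ≤ M) :
    IsBackwardBoundedAt u T x₀ :=
  isBackwardBoundedAt_of_localTypeI_inner_field_eq_zero ν T hν hT u p hcl hLH hdec x₀ ρ M hρ hM
    (n := fun _ => e) continuousAt_const he hρ fun t _ _ x _ => hpl t x

end Summit.NavierStokesRegularity.NavierStokesRegularity.Theorems.LocalVelCompTubeDoorOrthogonalField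

end
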